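import Summits.CriticalPhenomena.PercolationContinuityZ3.Theorems.PercNearOneGluingNoHeavyQuantRatioRegularCertificate
import Summits.CriticalPhenomena.PercolationContinuityZ3.Theorems.PercNearOneGluingNoHeavyQuantAverageGateStarRow
import HarnessLib

/-!
# QUANT lane R8 tool: the VERTEX FORM of the ratio-regular certificate, and its Poisson-binomial instance

builds on p205010 (kernel theorem, internal audit signed; external expert review pending)

Support file (`--supports stmt-CriticalPhenomena-4575`), QUANT lane typer seat prim-quant-stmt (gen 12); memo
`run/shared/lean/prim/quant/prim-quant-stmt-g12/MTL-PROFILE-LP.md` §4.  Theorems only; no definitions, no sorries, standard axioms.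

`Quant.ratioRegular_expectation_ge` (…QuantRatioRegularCertificate.lean) bounds `Σ_b p b · ℓ b ≥ τ` for every ratio-regular law `p`
once a separating multiplier `ν` is given.  Here the multiplier is produced from the VERTEX INEQUALITIES of the memo
(`ν := min_{n < b₁ ≤ m} (ℓ b₁ − τ)/(b₁ − μ)`), and the statement is instantiated for the count `N_L` of a finset of independent gates
(`Quant.pb_ratio`, `Quant.pb_mean`, `Quant.pb_levels_sum_one`):

* `Quant.ratioRegular_expectation_ge_of_vertices` — Poisson weights `w i = μ^i/i!`, `n ≤ μ < n + 1`, `n < m`: if for all `t ≤ n < b₁ ≤ m`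
  `(V_{t,b₁})   0 ≤ (Σ_{i=t}^{n} (ℓ i − τ) w i)·(b₁ − μ) + (ℓ b₁ − τ)·(Σ_{i=t}^{n} (μ − i) w i)`,
  then `τ ≤ Σ_{b ≤ m} p b · ℓ b` for every ratio-regular law `p` on `{0..m}` with mean `μ`.
* `Quant.pb_expectation_ge_of_vertices` — the same for `p b = P(N_L = b)` under `prodBernoulli`, `μ = U_L = Σ_{i∈L} p_i`, `m = |L|`,
  `n ≤ U_L < n + 1`, `n < |L|`: the vertex inequalities imply `τ ≤ Σ_{b ≤ |L|} P(N_L = b)·ℓ b`.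
With `ℓ b = P(W ≥ j+1−c−b) + ρ·P(W ≥ j+1)` (independent root blocks `W`) the right side is the hub-conditioned form of FAR for
'hub + leaf relays + root blocks', so FAR for that family at every layer is reduced, in the kernel, to the elementary inequalities `(V_{t,b₁})`
(exact census: 200 000 instances / 0 violations; memo §4–§6).  [this work]
-/

noncomputable section

namespace Summit.CriticalPhenomena.PercolationContinuityZ3.Theorems

namespace Quant

open Finset MeasureTheory
open Literature.Probability.LatticeModels
open Literature.Probability.Percolation
open scoped Classical

/-- **Vertex form of the certificate.**  Let `0 < μ`, `n ≤ μ < n + 1`, `n < m`.  If the vertex inequalities `(V_{t,b₁})` hold for all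
`t ≤ n < b₁ ≤ m`, then every law `p` on `{0,…,m}` with mean `μ` that is ratio-regular below the mean satisfies `τ ≤ Σ_{b ≤ m} p b · ℓ b`.
(`ν :=` the least slope `(ℓ b₁ − τ)/(b₁ − μ)` over the top atoms; `(V_{t,b*})` at the minimiser is the tail condition.) [this work] -/
theorem ratioRegular_expectation_ge_of_vertices (m n : ℕ) (μ τ : ℝ) (p ℓ : ℕ → ℝ) (hμ0 : 0 < μ) (hnμ : (n : ℝ) ≤ μ)
    (hμn : μ < n + 1) (hnm : n < m) (hp0 : ∀ b, 0 ≤ p b)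
    (hsum : ∑ b ∈ Finset.range (m + 1), p b = 1) (hmean : ∑ b ∈ Finset.range (m + 1), (b : ℝ) * p b = μ)
    (hratio : ∀ b, 1 ≤ b → b ≤ n → μ * p (b - 1) ≤ (b : ℝ) * p b)
    (hV : ∀ t b₁, t ≤ n → n < b₁ → b₁ ≤ m →
      0 ≤ (∑ i ∈ Finset.Ico t (n + 1), (ℓ i - τ) * (μ ^ i / (Nat.factorial i : ℝ))) * ((b₁ : ℝ) - μ) +
        (ℓ b₁ - τ) * ∑ i ∈ Finset.Ico t (n + 1), (μ - i) * (μ ^ i / (Nat.factorial i : ℝ))) :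
    τ ≤ ∑ b ∈ Finset.range (m + 1), p b * ℓ b := by
  -- the top atoms `n < b ≤ m` and the least slope
  set f : ℕ → ℝ := fun b => (ℓ b - τ) / ((b : ℝ) - μ) with hf
  have hne : (Finset.Ioc n m).Nonempty := ⟨m, by rw [Finset.mem_Ioc]; omega⟩
  obtain ⟨bs, hbs, hmin⟩ := Finset.exists_min_image (Finset.Ioc n m) f hne
  rw [Finset.mem_Ioc] at hbs
  set ν : ℝ := f bs with hν
  have hgap : ∀ b : ℕ, n < b → 0 < (b : ℝ) - μ := by
    intro b hb
    have : (n : ℝ) + 1 ≤ b := by exact_mod_cast hb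
    linarith
  -- (top) `ν (b − μ) ≤ ℓ b − τ`
  have htop : ∀ b, n < b → b ≤ m → ν * ((b : ℝ) - μ) ≤ ℓ b - τ := by
    intro b hb hbm
    have h1 : ν ≤ f b := hmin b (by rw [Finset.mem_Ioc]; exact ⟨hb, hbm⟩)
    have h2 : f b * ((b : ℝ) - μ) = ℓ b - τ := by
      rw [hf]
      field_simp [(hgap b hb).ne']
    calc ν * ((b : ℝ) - μ) ≤ f b * ((b : ℝ) - μ) := mul_le_mul_of_nonneg_right h1 (hgap b hb).le
      _ = ℓ b - τ := h2
  -- (tail) from `(V_{t, bs})`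
  have htail : ∀ t, t ≤ n →
      0 ≤ ∑ i ∈ Finset.Ico t (n + 1), (ℓ i - τ - ν * ((i : ℝ) - μ)) * (μ ^ i / (Nat.factorial i : ℝ)) := by
    intro t ht
    set S₁ : ℝ := ∑ i ∈ Finset.Ico t (n + 1), (ℓ i - τ) * (μ ^ i / (Nat.factorial i : ℝ)) with hS₁
    set D : ℝ := ∑ i ∈ Finset.Ico t (n + 1), (μ - i) * (μ ^ i / (Nat.factorial i : ℝ)) with hD
    have hVt := hV t bs ht hbs.1 hbs.2
    have hℓ : ℓ bs - τ = ν * ((bs : ℝ) - μ) := by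
      rw [hν, hf]
      field_simp [(hgap bs hbs.1).ne']
    rw [hℓ] at hVt
    -- `0 ≤ (bs − μ)·(S₁ + ν D)`
    have hfac : S₁ * ((bs : ℝ) - μ) + ν * ((bs : ℝ) - μ) * D = ((bs : ℝ) - μ) * (S₁ + ν * D) := by ring
    rw [hfac] at hVt
    have hSD : 0 ≤ S₁ + ν * D := (mul_nonneg_iff_of_pos_left (hgap bs hbs.1)).mp hVt
    have hre : ∑ i ∈ Finset.Ico t (n + 1), (ℓ i - τ - ν * ((i : ℝ) - μ)) * (μ ^ i / (Nat.factorial i : ℝ)) = S₁ + ν * D := by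
      rw [hS₁, hD, Finset.mul_sum, ← Finset.sum_add_distrib]
      exact Finset.sum_congr rfl fun i _ => by ring
    rw [hre]
    exact hSD
  exact ratioRegular_expectation_ge m n μ τ ν p ℓ hμ0 hnμ hp0 hsum hmean hratio htop htail

variable {ι : Type*} [Fintype ι]

/-- **Poisson-binomial instance.**  For independent gates `q` and a finset `L` with `U_L = Σ_{i∈L} q_i`, `n ≤ U_L < n + 1`, `n < |L|`:
if the vertex inequalities `(V_{t,b₁})` (Poisson weights `U_L^i/i!`) hold for a test function `ℓ` and level `τ` for all `t ≤ n < b₁ ≤ |L|`,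
then `τ ≤ Σ_{b ≤ |L|} P(N_L = b)·ℓ b`.  (The count law is ratio-regular by `Quant.pb_ratio`; mean and total mass by `Quant.pb_mean`,
`Quant.pb_levels_sum_one`.) [this work] -/
theorem pb_expectation_ge_of_vertices (q : ι → unitInterval) (L : Finset ι) (n : ℕ) (ℓ : ℕ → ℝ) (τ : ℝ)
    (hU0 : 0 < ∑ i ∈ L, (q i : ℝ)) (hnU : (n : ℝ) ≤ ∑ i ∈ L, (q i : ℝ)) (hUn : ∑ i ∈ L, (q i : ℝ) < n + 1)
    (hnL : n < L.card)
    (hV : ∀ t b₁, t ≤ n → n < b₁ → b₁ ≤ L.card →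
      0 ≤ (∑ i ∈ Finset.Ico t (n + 1), (ℓ i - τ) * ((∑ i ∈ L, (q i : ℝ)) ^ i / (Nat.factorial i : ℝ))) *
          ((b₁ : ℝ) - ∑ i ∈ L, (q i : ℝ)) +
        (ℓ b₁ - τ) * ∑ i ∈ Finset.Ico t (n + 1), ((∑ i ∈ L, (q i : ℝ)) - i) * ((∑ i ∈ L, (q i : ℝ)) ^ i / (Nat.factorial i : ℝ))) :
    τ ≤ ∑ b ∈ Finset.range (L.card + 1),
      (prodBernoulli q).real {s : Set ι | (L.filter fun x => x ∈ s).card = b} * ℓ b := by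
  set U : ℝ := ∑ i ∈ L, (q i : ℝ) with hU
  set P : ℕ → ℝ := fun b => (prodBernoulli q).real {s : Set ι | (L.filter fun x => x ∈ s).card = b} with hP
  have hp0 : ∀ b, 0 ≤ P b := fun b => measureReal_nonneg
  have hsum : ∑ b ∈ Finset.range (L.card + 1), P b = 1 := pb_levels_sum_one q L
  have hmean : ∑ b ∈ Finset.range (L.card + 1), (b : ℝ) * P b = U := pb_mean q L
  have hratio : ∀ b, 1 ≤ b → b ≤ n → U * P (b - 1) ≤ (b : ℝ) * P b := by
    intro b hb1 hbn
    have hbU : (b : ℝ) ≤ U := by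
      have : (b : ℝ) ≤ n := by exact_mod_cast hbn
      linarith
    exact pb_ratio q L b hb1 hbU
  exact ratioRegular_expectation_ge_of_vertices L.card n U τ P ℓ hU0 hnU hUn hnL hp0 hsum hmean hratio hV

end Quant

end Summit.CriticalPhenomena.PercolationContinuityZ3.Theorems
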